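import Literature.AnabelianGeometry.EtaleTheta.EqUpToRootOfUnityInstances
import Literature.AnabelianGeometry.EtaleTheta.Discharge.Sec2Cor28iEndKnitChiCusp
import Literature.AnabelianGeometry.EtaleTheta.Discharge.Sec2OrbitEmbeddingModelChiCusp
import HarnessLib

/-!
# [EtTh] Cor 2.8 (i): the `EqUpToRootOfUnity` instance forms (F-0642) at THE cover of record over the cusped inversion
# model `χ′` — binder-free ∃-forms, residual ∅ (proof-only)

S. Mochizuki, *The étale theta function and its Frobenioid-theoretic manifestations* [EtTh], Publ. RIMS **45** (2009), §2,
Cor 2.8 (i) PRIMS PDF p.42 («… a property that determines this collection of classes up to multiplication by a root of unity of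
order `l` (resp. `1`; `l`; `1`)»), Def 1.9 p.29 (`τ^{±1}`), Def 2.7 p.41 (bib key `MochizukiEtTh2009`).

PROOF-ONLY companion (0 `def`, 0 `instance`, no new `Prop`; cell abc-iut, block F, seat abc-iut-f-161 gen 8 — KEY F0642, sequel of
`EqUpToRootOfUnityInstances`; abc-iut-L2-lead R1382/R1383; every input BY NAME).  The ε-level instance theorems of
`EqUpToRootOfUnityInstances` (`ofEmbedding_cor28_i_C3C4_iff_transport_eq`, `ofEmbedding_exists_eqUpToRootOfUnity_innerAutTop`) hold
for EVERY orbit embedding; here they are recorded at the node's cover of record with NO hypothesis beyond `p` prime, `l` odd: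
* `exists_orbitEmbedding_eqUpToRootOfUnity_coverOfRecordχ'_tauχ'` — `p ≡ 1 (mod 4)`: THE cover of record of abc-iut-f-151's
  `exists_orbitEmbedding_isStandard_cor28_i_innerAutTop_inversionModelχ'` (abc-iut-L2-d3's orbit embedding of abc-iut-L2-t10's
  `doubleUnderlineχ′Sec p l` into a `TemperedCoverData` ON `Π^tp_C(inversionModelχ′ p)` whose points ARE the Def 1.9 pair
  `tauχ′` / `tauInvχ′`, `IsStandard` a theorem there): for abc-iut-L2-t2's orbit datum `O = ofEmbedding ε`, (a) for EVERY pair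
  `(Γ, Γ_Θ)` and every `hY`, conclusions C3/C4 of `Cor28_i` («order `1`») hold IFF `Γ` preserves `η̈^{Θ,ℤ×μ₂}` resp.
  `η̈^{Θ,l·ℤ×μ₂}` EXACTLY; (b) for every inner `γ_x`, `x ∈ Π^tp_{X̲̲}` of `T`, the induced `Γ_Θ` (`= act x`) and the stability
  witnesses EXIST and the three `EqUpToRootOfUnity` conclusions of `Cor28_i` (orders `l`, `1`, `1`) HOLD;
* `exists_orbitEmbedding_eqUpToRootOfUnity_inversionModelχ'` — the same (a), (b) for EVERY prime `p` at abc-iut-L2-t10's named data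
  (`nonempty_orbitEmbedding_doubleUnderlineχ'Sec`: both point slots `nonCuspidalPointχ′`; the statements read no `Dtau`).
HONEST FRAMING: semi-synthetic model = consistency / non-vacuity evidence for the TYPED predicate only; the non-inner `Γ` case of
C2–C4 is abc-iut-L2-t1's line, untouched; [EtTh] is refereed and nothing of it is asserted; no side is taken on [IUTchIII] Cor 3.12;
typed ≠ proved; instantiated ≠ endorsed.
-/

noncomputable section

namespace Literature.AnabelianGeometry.EtaleTheta.SettingModel

open Literature.AnabelianGeometry.SemiGraphs ThetaCovers ThetaSetting

variable (p : ℕ) [Fact p.Prime]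

/-- **F-0642 at THE cover of record with the Def 1.9 pair (`p ≡ 1 (mod 4)`, every odd `l`), residual ∅**: there are `T` ON
`Π^tp_C(inversionModelχ′ p)` and an orbit embedding `ε` of `doubleUnderlineχ′Sec p l` with `ε.tau = tauχ′`, `ε.tauInv = tauInvχ′`
(abc-iut-f-151's cover of record; `IsStandard` holds) such that for `O = ofEmbedding ε`: (a) for EVERY `(Γ, Γ_Θ, hY)`,
`EqUpToRootOfUnity 1 _ η̈^{Θ,ℤ×μ₂} (Γ·η̈^{Θ,ℤ×μ₂}) ↔ Γ·η̈^{Θ,ℤ×μ₂} = η̈^{Θ,ℤ×μ₂}` and likewise for `η̈^{Θ,l·ℤ×μ₂}`; (b) for every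
`x ∈ Π^tp_{X̲̲}` of `T`: `∃ Γ_Θ (= act x), hY, hYuu` with `InducesOnTheta (γ_x) Γ_Θ` and the three `EqUpToRootOfUnity` conclusions
of `Cor28_i` for `(γ_x, Γ_Θ)` (orders `l`, `1`, `1`). [cite: MochizukiEtTh2009, Cor 2.8(i) p.42] -/
theorem exists_orbitEmbedding_eqUpToRootOfUnity_coverOfRecordχ'_tauχ' (hp : p % 4 = 1) (l : ℕ+)
    (hodd : Odd ((l : ℕ+) : ℕ)) :
    ∃ (T : TemperedCoverData.{0} l) (ε : (doubleUnderlineχ'Sec p l hodd).OrbitEmbedding T),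
      T.Gtp = (MuTwoSetting.inversionModelχ' p).GtpC ∧ ε.tau = (tauχ' p hp).toNonCuspidalPoint ∧
      ε.tauInv = (tauInvχ' p hp).toNonCuspidalPoint ∧ (ThetaOrbitData.ofEmbedding ε (MuTwoSetting.inversionModelχ'_compat p) (ThetaSetting.modelχ'_sec2Hyps p)).IsStandard ∧
      (∀ (Γ : T.Gtp ≃ₜ* T.Gtp) (ΓΘ : (ThetaOrbitData.ofEmbedding ε (MuTwoSetting.inversionModelχ'_compat p) (ThetaSetting.modelχ'_sec2Hyps p)).DeltaTheta ≃* (ThetaOrbitData.ofEmbedding ε (MuTwoSetting.inversionModelχ'_compat p) (ThetaSetting.modelχ'_sec2Hyps p)).DeltaTheta)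
        (hY : T.PiYddtp.map Γ.toMulEquiv.toMonoidHom = T.PiYddtp),
        ((ThetaOrbitData.ofEmbedding ε (MuTwoSetting.inversionModelχ'_compat p) (ThetaSetting.modelχ'_sec2Hyps p)).EqUpToRootOfUnity 1 _ (ThetaOrbitData.ofEmbedding ε (MuTwoSetting.inversionModelχ'_compat p) (ThetaSetting.modelχ'_sec2Hyps p)).etaZMu2 ((ThetaOrbitData.ofEmbedding ε (MuTwoSetting.inversionModelχ'_compat p) (ThetaSetting.modelχ'_sec2Hyps p)).transport _ Γ hY ΓΘ (ThetaOrbitData.ofEmbedding ε (MuTwoSetting.inversionModelχ'_compat p) (ThetaSetting.modelχ'_sec2Hyps p)).etaZMu2) ↔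
          (ThetaOrbitData.ofEmbedding ε (MuTwoSetting.inversionModelχ'_compat p) (ThetaSetting.modelχ'_sec2Hyps p)).transport _ Γ hY ΓΘ (ThetaOrbitData.ofEmbedding ε (MuTwoSetting.inversionModelχ'_compat p) (ThetaSetting.modelχ'_sec2Hyps p)).etaZMu2 = (ThetaOrbitData.ofEmbedding ε (MuTwoSetting.inversionModelχ'_compat p) (ThetaSetting.modelχ'_sec2Hyps p)).etaZMu2) ∧
        ((ThetaOrbitData.ofEmbedding ε (MuTwoSetting.inversionModelχ'_compat p) (ThetaSetting.modelχ'_sec2Hyps p)).EqUpToRootOfUnity 1 _ (ThetaOrbitData.ofEmbedding ε (MuTwoSetting.inversionModelχ'_compat p) (ThetaSetting.modelχ'_sec2Hyps p)).etaLZMu2 ((ThetaOrbitData.ofEmbedding ε (MuTwoSetting.inversionModelχ'_compat p) (ThetaSetting.modelχ'_sec2Hyps p)).transport _ Γ hY ΓΘ (ThetaOrbitData.ofEmbedding ε (MuTwoSetting.inversionModelχ'_compat p) (ThetaSetting.modelχ'_sec2Hyps p)).etaLZMu2) ↔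
          (ThetaOrbitData.ofEmbedding ε (MuTwoSetting.inversionModelχ'_compat p) (ThetaSetting.modelχ'_sec2Hyps p)).transport _ Γ hY ΓΘ (ThetaOrbitData.ofEmbedding ε (MuTwoSetting.inversionModelχ'_compat p) (ThetaSetting.modelχ'_sec2Hyps p)).etaLZMu2 = (ThetaOrbitData.ofEmbedding ε (MuTwoSetting.inversionModelχ'_compat p) (ThetaSetting.modelχ'_sec2Hyps p)).etaLZMu2)) ∧
      (∀ x ∈ T.tp T.PiXuu,
        ∃ (ΓΘ : (ThetaOrbitData.ofEmbedding ε (MuTwoSetting.inversionModelχ'_compat p) (ThetaSetting.modelχ'_sec2Hyps p)).DeltaTheta ≃* (ThetaOrbitData.ofEmbedding ε (MuTwoSetting.inversionModelχ'_compat p) (ThetaSetting.modelχ'_sec2Hyps p)).DeltaTheta)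
          (hY : T.PiYddtp.map (ThetaOrbitData.innerAutTop x).toMulEquiv.toMonoidHom = T.PiYddtp)
          (hYuu : (T.PiYddtp ⊓ T.tp T.PiXuu).map (ThetaOrbitData.innerAutTop x).toMulEquiv.toMonoidHom =
            T.PiYddtp ⊓ T.tp T.PiXuu),
          (ThetaOrbitData.ofEmbedding ε (MuTwoSetting.inversionModelχ'_compat p) (ThetaSetting.modelχ'_sec2Hyps p)).InducesOnTheta (ThetaOrbitData.innerAutTop x) ΓΘ ∧ (∀ a, ΓΘ a = (ThetaOrbitData.ofEmbedding ε (MuTwoSetting.inversionModelχ'_compat p) (ThetaSetting.modelχ'_sec2Hyps p)).act x a) ∧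
          (ThetaOrbitData.ofEmbedding ε (MuTwoSetting.inversionModelχ'_compat p) (ThetaSetting.modelχ'_sec2Hyps p)).EqUpToRootOfUnity l _ (ThetaOrbitData.ofEmbedding ε (MuTwoSetting.inversionModelχ'_compat p) (ThetaSetting.modelχ'_sec2Hyps p)).rootLZMu2
              ((ThetaOrbitData.ofEmbedding ε (MuTwoSetting.inversionModelχ'_compat p) (ThetaSetting.modelχ'_sec2Hyps p)).transport _ (ThetaOrbitData.innerAutTop x) hYuu ΓΘ (ThetaOrbitData.ofEmbedding ε (MuTwoSetting.inversionModelχ'_compat p) (ThetaSetting.modelχ'_sec2Hyps p)).rootLZMu2) ∧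
            (ThetaOrbitData.ofEmbedding ε (MuTwoSetting.inversionModelχ'_compat p) (ThetaSetting.modelχ'_sec2Hyps p)).EqUpToRootOfUnity 1 _ (ThetaOrbitData.ofEmbedding ε (MuTwoSetting.inversionModelχ'_compat p) (ThetaSetting.modelχ'_sec2Hyps p)).etaZMu2
              ((ThetaOrbitData.ofEmbedding ε (MuTwoSetting.inversionModelχ'_compat p) (ThetaSetting.modelχ'_sec2Hyps p)).transport _ (ThetaOrbitData.innerAutTop x) hY ΓΘ (ThetaOrbitData.ofEmbedding ε (MuTwoSetting.inversionModelχ'_compat p) (ThetaSetting.modelχ'_sec2Hyps p)).etaZMu2) ∧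
            (ThetaOrbitData.ofEmbedding ε (MuTwoSetting.inversionModelχ'_compat p) (ThetaSetting.modelχ'_sec2Hyps p)).EqUpToRootOfUnity 1 _ (ThetaOrbitData.ofEmbedding ε (MuTwoSetting.inversionModelχ'_compat p) (ThetaSetting.modelχ'_sec2Hyps p)).etaLZMu2
              ((ThetaOrbitData.ofEmbedding ε (MuTwoSetting.inversionModelχ'_compat p) (ThetaSetting.modelχ'_sec2Hyps p)).transport _ (ThetaOrbitData.innerAutTop x) hY ΓΘ (ThetaOrbitData.ofEmbedding ε (MuTwoSetting.inversionModelχ'_compat p) (ThetaSetting.modelχ'_sec2Hyps p)).etaLZMu2)) := by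
  obtain ⟨T, ε, hT, hτ, hτ', hstd, -⟩ := exists_orbitEmbedding_isStandard_cor28_i_innerAutTop_inversionModelχ' p hp l hodd
  exact ⟨T, ε, hT, hτ, hτ', hstd,
    fun Γ ΓΘ hY => ThetaOrbitData.ofEmbedding_cor28_i_C3C4_iff_transport_eq ε _ _ Γ ΓΘ hY,
    fun x hx => ThetaOrbitData.ofEmbedding_exists_eqUpToRootOfUnity_innerAutTop ε _ _ hx⟩

/-- **F-0642 at the named data for EVERY prime `p` (every odd `l`), residual ∅**: on `Π^tp_C(inversionModelχ′ p)` there are `T`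
and an orbit embedding `ε` of `doubleUnderlineχ′Sec p l` (abc-iut-L2-t10's `nonempty_orbitEmbedding_doubleUnderlineχ'Sec`; point
slots `nonCuspidalPointχ′`, not read here) with (a) and (b) as above for `O = ofEmbedding ε`. [cite: MochizukiEtTh2009, Cor 2.8(i) p.42] -/
theorem exists_orbitEmbedding_eqUpToRootOfUnity_inversionModelχ' (l : ℕ+) (hodd : Odd ((l : ℕ+) : ℕ)) :
    ∃ (T : TemperedCoverData.{0} l) (ε : (doubleUnderlineχ'Sec p l hodd).OrbitEmbedding T),
      T.Gtp = (MuTwoSetting.inversionModelχ' p).GtpC ∧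
      (∀ (Γ : T.Gtp ≃ₜ* T.Gtp) (ΓΘ : (ThetaOrbitData.ofEmbedding ε (MuTwoSetting.inversionModelχ'_compat p) (ThetaSetting.modelχ'_sec2Hyps p)).DeltaTheta ≃* (ThetaOrbitData.ofEmbedding ε (MuTwoSetting.inversionModelχ'_compat p) (ThetaSetting.modelχ'_sec2Hyps p)).DeltaTheta)
        (hY : T.PiYddtp.map Γ.toMulEquiv.toMonoidHom = T.PiYddtp),
        ((ThetaOrbitData.ofEmbedding ε (MuTwoSetting.inversionModelχ'_compat p) (ThetaSetting.modelχ'_sec2Hyps p)).EqUpToRootOfUnity 1 _ (ThetaOrbitData.ofEmbedding ε (MuTwoSetting.inversionModelχ'_compat p) (ThetaSetting.modelχ'_sec2Hyps p)).etaZMu2 ((ThetaOrbitData.ofEmbedding ε (MuTwoSetting.inversionModelχ'_compat p) (ThetaSetting.modelχ'_sec2Hyps p)).transport _ Γ hY ΓΘ (ThetaOrbitData.ofEmbedding ε (MuTwoSetting.inversionModelχ'_compat p) (ThetaSetting.modelχ'_sec2Hyps p)).etaZMu2) ↔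
          (ThetaOrbitData.ofEmbedding ε (MuTwoSetting.inversionModelχ'_compat p) (ThetaSetting.modelχ'_sec2Hyps p)).transport _ Γ hY ΓΘ (ThetaOrbitData.ofEmbedding ε (MuTwoSetting.inversionModelχ'_compat p) (ThetaSetting.modelχ'_sec2Hyps p)).etaZMu2 = (ThetaOrbitData.ofEmbedding ε (MuTwoSetting.inversionModelχ'_compat p) (ThetaSetting.modelχ'_sec2Hyps p)).etaZMu2) ∧
        ((ThetaOrbitData.ofEmbedding ε (MuTwoSetting.inversionModelχ'_compat p) (ThetaSetting.modelχ'_sec2Hyps p)).EqUpToRootOfUnity 1 _ (ThetaOrbitData.ofEmbedding ε (MuTwoSetting.inversionModelχ'_compat p) (ThetaSetting.modelχ'_sec2Hyps p)).etaLZMu2 ((ThetaOrbitData.ofEmbedding ε (MuTwoSetting.inversionModelχ'_compat p) (ThetaSetting.modelχ'_sec2Hyps p)).transport _ Γ hY ΓΘ (ThetaOrbitData.ofEmbedding ε (MuTwoSetting.inversionModelχ'_compat p) (ThetaSetting.modelχ'_sec2Hyps p)).etaLZMu2) ↔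
          (ThetaOrbitData.ofEmbedding ε (MuTwoSetting.inversionModelχ'_compat p) (ThetaSetting.modelχ'_sec2Hyps p)).transport _ Γ hY ΓΘ (ThetaOrbitData.ofEmbedding ε (MuTwoSetting.inversionModelχ'_compat p) (ThetaSetting.modelχ'_sec2Hyps p)).etaLZMu2 = (ThetaOrbitData.ofEmbedding ε (MuTwoSetting.inversionModelχ'_compat p) (ThetaSetting.modelχ'_sec2Hyps p)).etaLZMu2)) ∧
      (∀ x ∈ T.tp T.PiXuu,
        ∃ (ΓΘ : (ThetaOrbitData.ofEmbedding ε (MuTwoSetting.inversionModelχ'_compat p) (ThetaSetting.modelχ'_sec2Hyps p)).DeltaTheta ≃* (ThetaOrbitData.ofEmbedding ε (MuTwoSetting.inversionModelχ'_compat p) (ThetaSetting.modelχ'_sec2Hyps p)).DeltaTheta)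
          (hY : T.PiYddtp.map (ThetaOrbitData.innerAutTop x).toMulEquiv.toMonoidHom = T.PiYddtp)
          (hYuu : (T.PiYddtp ⊓ T.tp T.PiXuu).map (ThetaOrbitData.innerAutTop x).toMulEquiv.toMonoidHom =
            T.PiYddtp ⊓ T.tp T.PiXuu),
          (ThetaOrbitData.ofEmbedding ε (MuTwoSetting.inversionModelχ'_compat p) (ThetaSetting.modelχ'_sec2Hyps p)).InducesOnTheta (ThetaOrbitData.innerAutTop x) ΓΘ ∧ (∀ a, ΓΘ a = (ThetaOrbitData.ofEmbedding ε (MuTwoSetting.inversionModelχ'_compat p) (ThetaSetting.modelχ'_sec2Hyps p)).act x a) ∧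
          (ThetaOrbitData.ofEmbedding ε (MuTwoSetting.inversionModelχ'_compat p) (ThetaSetting.modelχ'_sec2Hyps p)).EqUpToRootOfUnity l _ (ThetaOrbitData.ofEmbedding ε (MuTwoSetting.inversionModelχ'_compat p) (ThetaSetting.modelχ'_sec2Hyps p)).rootLZMu2
              ((ThetaOrbitData.ofEmbedding ε (MuTwoSetting.inversionModelχ'_compat p) (ThetaSetting.modelχ'_sec2Hyps p)).transport _ (ThetaOrbitData.innerAutTop x) hYuu ΓΘ (ThetaOrbitData.ofEmbedding ε (MuTwoSetting.inversionModelχ'_compat p) (ThetaSetting.modelχ'_sec2Hyps p)).rootLZMu2) ∧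
            (ThetaOrbitData.ofEmbedding ε (MuTwoSetting.inversionModelχ'_compat p) (ThetaSetting.modelχ'_sec2Hyps p)).EqUpToRootOfUnity 1 _ (ThetaOrbitData.ofEmbedding ε (MuTwoSetting.inversionModelχ'_compat p) (ThetaSetting.modelχ'_sec2Hyps p)).etaZMu2
              ((ThetaOrbitData.ofEmbedding ε (MuTwoSetting.inversionModelχ'_compat p) (ThetaSetting.modelχ'_sec2Hyps p)).transport _ (ThetaOrbitData.innerAutTop x) hY ΓΘ (ThetaOrbitData.ofEmbedding ε (MuTwoSetting.inversionModelχ'_compat p) (ThetaSetting.modelχ'_sec2Hyps p)).etaZMu2) ∧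
            (ThetaOrbitData.ofEmbedding ε (MuTwoSetting.inversionModelχ'_compat p) (ThetaSetting.modelχ'_sec2Hyps p)).EqUpToRootOfUnity 1 _ (ThetaOrbitData.ofEmbedding ε (MuTwoSetting.inversionModelχ'_compat p) (ThetaSetting.modelχ'_sec2Hyps p)).etaLZMu2
              ((ThetaOrbitData.ofEmbedding ε (MuTwoSetting.inversionModelχ'_compat p) (ThetaSetting.modelχ'_sec2Hyps p)).transport _ (ThetaOrbitData.innerAutTop x) hY ΓΘ (ThetaOrbitData.ofEmbedding ε (MuTwoSetting.inversionModelχ'_compat p) (ThetaSetting.modelχ'_sec2Hyps p)).etaLZMu2)) := by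
  obtain ⟨T, hT, ⟨ε⟩⟩ := nonempty_orbitEmbedding_doubleUnderlineχ'Sec p l hodd
  exact ⟨T, ε, hT,
    fun Γ ΓΘ hY => ThetaOrbitData.ofEmbedding_cor28_i_C3C4_iff_transport_eq ε _ _ Γ ΓΘ hY,
    fun x hx => ThetaOrbitData.ofEmbedding_exists_eqUpToRootOfUnity_innerAutTop ε _ _ hx⟩

end Literature.AnabelianGeometry.EtaleTheta.SettingModel

end
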